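import Literature.AnabelianGeometry.EtaleTheta.Discharge.Sec1Prop15iiiOfCoreGenerator
import Literature.AnabelianGeometry.EtaleTheta.Discharge.Sec2ThetaOrbitClasses
import Literature.AnabelianGeometry.EtaleTheta.ThetaKummerDeck
import Literature.AnabelianGeometry.EtaleTheta.ThetaKummerTranslates
import Literature.AnabelianGeometry.EtaleTheta.ThetaLiftUnique
import HarnessLib

/-!
# [EtTh] Prop. 1.5 (iii): the `Z`-action display as a THEOREM of the Kummer theory of functions
# (print's own proof: "Assertion (iii) follows from Propositions 1.3; 1.4, (ii), (iii)") — proof-only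

S. Mochizuki, *The étale theta function and its Frobenioid-theoretic manifestations*, Publ. RIMS **45**
(2009) [EtTh], §1, Prop. 1.5 (iii), PRIMS PDF p. 23 (printed 249): "Any class `η̈^Θ ∈ H¹(Π^tp_Ÿ, Δ_Θ)` arises
from a unique class `η̈^Θ ∈ H¹((Π^tp_Ÿ)^Θ, Δ_Θ)` that maps to `log(Θ)` in the quotient `F̈⁰/F̈¹` and on which
`a ∈ Z ≅ Ẑ ≅ Π^tp_X/Π^tp_Y` acts as follows: `η̈^Θ ↦ η̈^Θ − 2a·log(Ü) − (a²/2)·log(q_X) + log(O^×_K̈)`"; printed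
proof (p. 23, last line): "Assertion (iii) follows from Propositions 1.3; 1.4, (ii), (iii)."
[cite: MochizukiEtTh2009, Prop 1.5 (iii) p.23]. Layer L2 of the abc-iut cell, seat abc-iut-L2-t12 (gen 7).
PROOF-ONLY (no `def`, no instance, no `Prop` fact), consumed BY NAME, nothing restated.

WHAT THIS FILE DOES. The tree's reductions of the typed `ThetaSetting.Prop15iii` end at four CLASS-LEVEL
binders (abc-iut-L2-t12 gen 5, `KummerCore.prop15iii_etaleThetaDataOfClass_of_generator` /
`…_ofSection_of_generator`, `Discharge/Sec1Prop15iiiOfCoreGenerator.lean`): at ONE `σ₀` with `toZ σ₀ = 1` and on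
`Π^tp_Y`, `σ₀·log(Ü) = log(Ü)·κ(q̈)·κ(u)`, `y·log(Ü) ∈ log(Ü)·κ(O^×)` and, for a `Θ`-lift `x′` of the class,
`σ₀·x′ = x′·log(Ü)^{−2}·κ(q̈)^{−1}·κ(u)`, `y·x′ ∈ x′·κ(O^×)`. HERE these four displays become THEOREMS of
FUNCTION-LEVEL identities read on abc-iut-L2-t12's (gen 0) Kummer theory of functions `ThetaKummerInput T`
(`ThetaKummerClass.lean`: the function module `T.Fn` with its `Π^tp_X`-action by pull-back, `Θ̈ = T.theta`, the
constants `T.const`, `κ` = the continuous Kummer class `CyclotomeCoefficients.kummerContClass` in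
`H¹(Π^tp_Ÿ, Δ_Θ)`), exactly as print says:
* Prop. 1.4 (iii) ("the classes `O^×_K̈ · η̈^Θ` … are precisely the Kummer classes associated to `O^×_K̈`-multiples
  of `Θ̈`"): `η̈^Θ := κ(Θ̈) = T.kummerTheta`; "`log(Ü)`", which the frozen `KummerData` carries as an abstract class
  ("the Kummer class of the square root `Ü ∈ Γ(Ü, O^×_Ü)`", p. 21), is the Kummer class of a coordinate FUNCTION
  `Ü ∈ Fn^{Π^tp_Ÿ}` — hypothesis `hlogU : infl(log(Ü)) = κ(Ü)`; the constants of the Kummer datum are those of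
  `T` — abc-iut-L2-t12's `ConstCompat` (`infl κ_E(c) = κ_T(c)`).
* Prop. 1.4 (ii) ("`Θ̈(q_X^{a/2} Ü) = (−1)^a q_X^{−a²/2} Ü^{−2a} Θ̈(Ü)`") at the generator `a = 1`, as identities of
  FUNCTIONS under the deck generator `σ₀` (the translation `Ü ↦ q̈·Ü` up to the sign of its lift to `Ÿ`):
  `σ₀ • Ü = const(u·q̈)·Ü`, `σ₀ • Θ̈ = const(u′·q̈⁻¹)·Ü^{−2}·Θ̈` with `u, u′ ∈ O^×_K̈` (print: `u = ±1`, `u′ = −1`);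
  and on `Π^tp_Y` (deck group `Gal(Ÿ/Y) = {±1}`, "`Θ̈(−Ü) = −Θ̈(Ü)`"): `y • Ü = const(±1)·Ü`, `y • Θ̈ = const(±1)·Θ̈`
  — the latter is abc-iut-w5-d125's `hdeck` (`ThetaKummerDeck.lean`), see `thetaUnitLaw_of_deck`.
* Prop. 1.3: the `Θ`-lift `x′` of `κ(Θ̈)` with `res_{Δ_Θ} x′ = log(Θ)` stays the ONE structural binder ("arises
  from a unique class": existence = the construction of Prop. 1.3; uniqueness = abc-iut-L2-t12's gen-0
  `inflTheta_injective`, by which the displays DESCEND from `H¹(Π^tp_Ÿ, Δ_Θ)` to the lift).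
Mechanism: equivariance and multiplicativity of the continuous Kummer class (abc-iut-w5-d125's
`CyclotomeCoefficients.conj_kummerContClass_of_smul_eq`, `kummerContClass_cast`; abc-iut-L2-t12's
`kummerContClass_mul`; `kummerContClass_inv` here) and the naturality `infl ∘ conj = conj ∘ infl`
(abc-iut-L2-t8's `ContH1.infl_conj`).

RESULTS: `EtaleThetaData.prop15iii_of_thetaKummerInput` (any étale-theta datum with `η̈^Θ = κ(Θ̈)` over any Kummer
datum; keeps the three Kummer-side binders `hkres`/`hU`/`hQ` of the generator reductions),
`KummerCore.prop15iii_…_of_thetaKummerInput` and `KummerCore.prop15iii_…_ofSection_of_thetaKummerInput` (Kummer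
core / section datum: those three are abc-iut-L2-t12's gen-5 THEOREMS). HONEST RESIDUAL: the `Θ`-lift of `κ(Θ̈)` (Prop. 1.3), `ConstCompat` + `hlogU` (Prop. 1.4 (iii))
and the four function identities (Prop. 1.4 (ii)) — i.e. precisely "Propositions 1.3; 1.4, (ii), (iii)".
Nothing of [EtTh] is asserted; classical Kummer theory over the frozen root; typed ≠ proved; no side is taken
on [IUTchIII] Cor. 3.12.
-/

noncomputable section

namespace Literature.AnabelianGeometry.EtaleTheta

open Literature.AnabelianGeometry.SemiGraphs

namespace ThetaSetting

variable {p : ℕ} [Fact p.Prime] {D : ThetaSetting p}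

/-- `−1 ∈ O^×_K̈` (absolute value `1`), at any theta setting. [cite: MochizukiEtTh2009, §1 p.17] -/
theorem neg_one_mem_unitsOKdd : (-1 : (↥D.Kdd)ˣ) ∈ D.unitsOKdd := by
  show ‖(((-1 : (↥D.Kdd)ˣ) : D.Kdd) : PadicAlgCl p)‖ = 1
  rw [Units.val_neg, Units.val_one]
  push_cast
  rw [norm_neg, norm_one]

/-- Naturality used throughout: inflation `H¹((Π^tp_Ÿ)^Θ, Δ_Θ) → H¹(Π^tp_Ÿ, Δ_Θ)` intertwines the conjugation
actions of `σ ∈ Π^tp_X` (abc-iut-L2-t8's `ContH1.infl_conj`, specialised). [cite: MochizukiEtTh2009, Prop 1.5 (iii) p.23] -/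
theorem inflTheta_conj_toTheta (hC : D.Compat) (σ : D.PiTemp) (z : D.H1Theta (D.GtpYdd.map D.toTheta)) :
    haveI := hC.GtpYdd_normal
    haveI := hC.GtpYddTheta_normal
    D.inflTheta D.GtpYdd (ContH1.conj (MonoidHom.id D.GtpTheta) D.DeltaTheta (D.toTheta σ) z) =
      ContH1.conj D.toTheta D.DeltaTheta σ (D.inflTheta D.GtpYdd z) := by
  haveI := hC.GtpYdd_normal
  haveI := hC.GtpYddTheta_normal
  exact ContH1.infl_conj (H₀ := D.GtpYdd) (H' := D.GtpYdd.map D.toTheta)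
    (hψ := D.continuous_toTheta) le_rfl σ z

namespace ThetaKummerInput

variable (T : D.ThetaKummerInput)

/-! ### 1. Function-level identities ⇒ identities of Kummer classes in `H¹(Π^tp_Ÿ, Δ_Θ)` -/

/-- `c · g` is `Π^tp_Ÿ`-invariant when `g` is. [cite: MochizukiEtTh2009, Prop 1.4 (iii) p.22] -/
theorem const_mul_mem (c : (↥D.Kdd)ˣ) {g : T.Fn} (hg : g ∈ MulAction.fixedPoints D.GtpYdd T.Fn) :
    T.const c * g ∈ MulAction.fixedPoints D.GtpYdd T.Fn := fun k => by
  change (k : D.PiTemp) • (T.const c * g) = T.const c * g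
  rw [smul_mul', show (k : D.PiTemp) • T.const c = T.const c from T.const_mem c k,
    show (k : D.PiTemp) • g = g from hg k]

/-- Products of `Π^tp_Ÿ`-invariant functions are invariant. [cite: MochizukiEtTh2009, Prop 1.4 (iii) p.22] -/
theorem mul_mem {f g : T.Fn} (hf : f ∈ MulAction.fixedPoints D.GtpYdd T.Fn)
    (hg : g ∈ MulAction.fixedPoints D.GtpYdd T.Fn) : f * g ∈ MulAction.fixedPoints D.GtpYdd T.Fn := fun k => by
  change (k : D.PiTemp) • (f * g) = f * g
  rw [smul_mul', show (k : D.PiTemp) • f = f from hf k, show (k : D.PiTemp) • g = g from hg k]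

/-- Inverses of `Π^tp_Ÿ`-invariant functions are invariant. [cite: MochizukiEtTh2009, Prop 1.4 (iii) p.22] -/
theorem inv_mem {f : T.Fn} (hf : f ∈ MulAction.fixedPoints D.GtpYdd T.Fn) :
    f⁻¹ ∈ MulAction.fixedPoints D.GtpYdd T.Fn := fun k => by
  change (k : D.PiTemp) • f⁻¹ = f⁻¹
  rw [smul_inv', show (k : D.PiTemp) • f = f from hf k]

/-- **The Kummer class of the inverse root system is the inverse class**: `κ(x⁻¹) = κ(x)⁻¹`
(`κ(x⁻¹)·κ(x) = κ(x⁻¹·x) = κ(1) = 1`). [cite: MochizukiEtTh2009, Prop 1.3 p.21] -/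
theorem kummerContClass_inv {f : T.Fn} (hf : f ∈ MulAction.fixedPoints D.GtpYdd T.Fn) (x : RootSystem f) :
    T.coeff.kummerContClass D.GtpYdd x.inv (T.inv_mem hf) (fun _ => T.isOpen_stabilizer _) =
      (T.coeff.kummerContClass D.GtpYdd x hf fun _ => T.isOpen_stabilizer _)⁻¹ := by
  apply eq_inv_of_mul_eq_one_left
  have h1 : (1 : T.Fn) ∈ MulAction.fixedPoints D.GtpYdd T.Fn := fun k => smul_one (k : D.PiTemp)
  rw [← T.coeff.kummerContClass_mul D.GtpYdd x.inv x (T.inv_mem hf) hf (T.mul_mem (T.inv_mem hf) hf)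
      (fun _ => T.isOpen_stabilizer _) (fun _ => T.isOpen_stabilizer _) (fun _ => T.isOpen_stabilizer _),
    T.coeff.kummerContClass_eq D.GtpYdd (x.inv.mul x) (RootSystem.one.cast (inv_mul_cancel f).symm)
      (T.mul_mem (T.inv_mem hf) hf) (fun _ => T.isOpen_stabilizer _) (fun _ => T.isOpen_stabilizer _),
    T.coeff.kummerContClass_cast D.GtpYdd RootSystem.one (inv_mul_cancel f).symm h1
      (T.mul_mem (T.inv_mem hf) hf) (fun _ => T.isOpen_stabilizer _) (fun _ => T.isOpen_stabilizer _)]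
  exact T.coeff.kummerContClass_one D.GtpYdd h1 _

/-- **Equivariance read on a function identity with a constant factor**: if `σ • f = const(c) · g` in `Fn`
(`f, g` on `Ÿ`), then `σ·κ(f) = κ(c)·κ(g)` in `H¹(Π^tp_Ÿ, Δ_Θ)` — abc-iut-w5-d125's
`conj_kummerContClass_of_smul_eq` followed by multiplicativity. [cite: MochizukiEtTh2009, Prop 1.4 (iii) p.22] -/
theorem conj_kummerContClass_of_smul_eq_const_mul [D.GtpYdd.Normal] {f g : T.Fn}
    (hf : f ∈ MulAction.fixedPoints D.GtpYdd T.Fn) (hg : g ∈ MulAction.fixedPoints D.GtpYdd T.Fn)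
    (x : RootSystem f) (y : RootSystem g) (σ : D.PiTemp) (c : (↥D.Kdd)ˣ) (h : σ • f = T.const c * g) :
    ContH1.conj D.toTheta D.DeltaTheta σ (T.coeff.kummerContClass D.GtpYdd x hf fun _ => T.isOpen_stabilizer _) =
      T.kummerConst c * T.coeff.kummerContClass D.GtpYdd y hg fun _ => T.isOpen_stabilizer _ := by
  rw [T.coeff.conj_kummerContClass_of_smul_eq D.GtpYdd σ x ((T.constRoots c).mul y) hf (T.const_mul_mem c hg)
      (fun _ => T.isOpen_stabilizer _) (fun _ => T.isOpen_stabilizer _) (fun _ => T.isOpen_stabilizer _) h,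
    kummerConst]
  exact T.coeff.kummerContClass_mul D.GtpYdd (T.constRoots c) y (T.const_mem c) hg (T.const_mul_mem c hg) _ _ _

/-- `κ(c⁻¹) = κ(c)⁻¹` for constants. [cite: MochizukiEtTh2009, Prop 1.3 p.21] -/
theorem kummerConst_inv (c : (↥D.Kdd)ˣ) : T.kummerConst c⁻¹ = (T.kummerConst c)⁻¹ :=
  eq_inv_of_mul_eq_one_left (by rw [← T.kummerConst_mul, inv_mul_cancel, T.kummerConst_one])

/-- **The coordinate law on classes**: from "`σ • Ü = const(c)·Ü`" (the deck generator translates the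
coordinate, `Ü ↦ ±q̈·Ü`; elements of `Π^tp_Y` change at most its sign), `σ·κ(Ü) = κ(Ü)·κ(c)`.
[cite: MochizukiEtTh2009, Prop 1.4 (ii) p.22] -/
theorem conj_kummerContClass_coord [D.GtpYdd.Normal] {udd : T.Fn}
    (hu : udd ∈ MulAction.fixedPoints D.GtpYdd T.Fn) (w : RootSystem udd) (σ : D.PiTemp) (c : (↥D.Kdd)ˣ)
    (h : σ • udd = T.const c * udd) :
    ContH1.conj D.toTheta D.DeltaTheta σ (T.coeff.kummerContClass D.GtpYdd w hu fun _ => T.isOpen_stabilizer _) =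
      (T.coeff.kummerContClass D.GtpYdd w hu fun _ => T.isOpen_stabilizer _) * T.kummerConst c := by
  rw [T.conj_kummerContClass_of_smul_eq_const_mul hu hu w w σ c h, mul_comm]

/-- **The theta law on classes — Prop. 1.4 (ii) at `a = 1` read through Kummer theory**: from
"`σ • Θ̈ = const(c)·Ü^{−2}·Θ̈`" (`Θ̈(q_X^{1/2}Ü) = −q_X^{−1/2}·Ü^{−2}·Θ̈(Ü)`, `c = −q̈^{−1}`),
`σ·κ(Θ̈) = κ(Θ̈)·κ(Ü)^{−2}·κ(c)`. [cite: MochizukiEtTh2009, Prop 1.4 (ii) p.22] -/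
theorem conj_kummerTheta_of_translate [D.GtpYdd.Normal] {udd : T.Fn}
    (hu : udd ∈ MulAction.fixedPoints D.GtpYdd T.Fn) (w : RootSystem udd) (σ : D.PiTemp) (c : (↥D.Kdd)ˣ)
    (h : σ • T.theta = T.const c * udd ^ (-(2 : ℤ)) * T.theta) :
    ContH1.conj D.toTheta D.DeltaTheta σ T.kummerTheta =
      T.kummerTheta * (T.coeff.kummerContClass D.GtpYdd w hu fun _ => T.isOpen_stabilizer _) ^ (-(2 : ℤ)) *
        T.kummerConst c := by
  -- a root system of `Ü^{−2} = (Ü·Ü)⁻¹`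
  have e2 : (udd * udd)⁻¹ = udd ^ (-(2 : ℤ)) := by rw [zpow_neg, zpow_two]
  have hu2 : udd ^ (-(2 : ℤ)) ∈ MulAction.fixedPoints D.GtpYdd T.Fn := by
    rw [← e2]; exact T.inv_mem (T.mul_mem hu hu)
  have hW : T.coeff.kummerContClass D.GtpYdd (((w.mul w).inv).cast e2) hu2 (fun _ => T.isOpen_stabilizer _) =
      (T.coeff.kummerContClass D.GtpYdd w hu fun _ => T.isOpen_stabilizer _) ^ (-(2 : ℤ)) := by
    rw [T.coeff.kummerContClass_cast D.GtpYdd (w.mul w).inv e2 (T.inv_mem (T.mul_mem hu hu)) hu2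
        (fun _ => T.isOpen_stabilizer _) (fun _ => T.isOpen_stabilizer _),
      T.kummerContClass_inv (T.mul_mem hu hu) (w.mul w),
      T.coeff.kummerContClass_mul D.GtpYdd w w hu hu (T.mul_mem hu hu) (fun _ => T.isOpen_stabilizer _)
        (fun _ => T.isOpen_stabilizer _) (fun _ => T.isOpen_stabilizer _), zpow_neg, zpow_two]
  have h' : σ • T.theta = T.const c * (udd ^ (-(2 : ℤ)) * T.theta) := by rw [h, mul_assoc]
  rw [kummerTheta, T.conj_kummerContClass_of_smul_eq_const_mul T.theta_mem (T.mul_mem hu2 T.theta_mem)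
      T.thetaRoots ((((w.mul w).inv).cast e2).mul T.thetaRoots) σ c h',
    T.coeff.kummerContClass_mul D.GtpYdd (((w.mul w).inv).cast e2) T.thetaRoots hu2 T.theta_mem
      (T.mul_mem hu2 T.theta_mem) (fun _ => T.isOpen_stabilizer _) (fun _ => T.isOpen_stabilizer _)
      (fun _ => T.isOpen_stabilizer _), hW, ← kummerTheta]
  simp only [mul_comm]

/-- The `Π^tp_Y`-law for `Θ̈` from abc-iut-w5-d125's deck hypothesis `hdeck` («`Θ̈(−Ü) = −Θ̈(Ü)`»): every
`y ∈ Π^tp_Y` pulls `Θ̈` back to a UNIT multiple (`1` on `Π^tp_Ÿ`, `−1` off it). [cite: MochizukiEtTh2009, Prop 1.4 (ii) p.22] -/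
theorem thetaUnitLaw_of_deck
    (hdeck : ∀ ε : D.PiTemp, ε ∈ D.GtpY → ε ∉ D.GtpYdd → ε • T.theta = T.const (-1) * T.theta) :
    ∀ y ∈ D.GtpY, ∃ u ∈ D.unitsOKdd, y • T.theta = T.const u * T.theta := by
  intro y hy
  by_cases hydd : y ∈ D.GtpYdd
  · exact ⟨1, one_mem _, by rw [map_one, one_mul]; exact T.theta_mem ⟨y, hydd⟩⟩
  · exact ⟨-1, D.neg_one_mem_unitsOKdd, hdeck y hy hydd⟩

/-! ### 2. Descent to the `Θ`-lift: the four class-level displays of the generator reductions -/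

section Displays

variable (E : D.KummerData) (hcc : T.ConstCompat E) {udd : T.Fn}
  (hu : udd ∈ MulAction.fixedPoints D.GtpYdd T.Fn) (w : RootSystem udd)
  (hlogU : D.inflTheta D.GtpYdd E.logUdd = T.coeff.kummerContClass D.GtpYdd w hu fun _ => T.isOpen_stabilizer _)

include hcc hlogU in
/-- **`log(Ü)`-display from a function identity**: `σ • Ü = const(c)·Ü` ⇒ `σ·log(Ü) = log(Ü)·κ_E(c)` on
`H¹((Π^tp_Ÿ)^Θ, Δ_Θ)` (descent along the injective inflation). [cite: MochizukiEtTh2009, Prop 1.5 (iii) p.23] -/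
theorem conj_logUdd_of_smul_eq (hC : D.Compat) (σ : D.PiTemp) (c : (↥D.Kdd)ˣ) (h : σ • udd = T.const c * udd) :
    haveI := hC.GtpYddTheta_normal
    ContH1.conj (MonoidHom.id D.GtpTheta) D.DeltaTheta (D.toTheta σ) E.logUdd =
      E.logUdd * E.kumYdd (E.toKddHat c) := by
  haveI := hC.GtpYdd_normal
  haveI := hC.GtpYddTheta_normal
  apply D.inflTheta_injective D.GtpYdd
  rw [D.inflTheta_conj_toTheta hC, map_mul, hlogU, hcc c]
  exact T.conj_kummerContClass_coord hu w σ c h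

include hcc hlogU in
/-- **The binder `hL₀`**: from `σ₀ • Ü = const(u·q̈)·Ü`, `σ₀·log(Ü) = log(Ü)·κ(q̈)·κ(u)`.
[cite: MochizukiEtTh2009, Prop 1.5 (iii) p.23] -/
theorem hL_of_coordLaw (hC : D.Compat) {σ₀ : D.PiTemp}
    (hU₀ : ∃ u ∈ D.unitsOKdd, σ₀ • udd = T.const (u * D.qddUnit) * udd) :
    haveI := hC.GtpYddTheta_normal
    ∃ u ∈ D.unitsOKdd, ContH1.conj (MonoidHom.id D.GtpTheta) D.DeltaTheta (D.toTheta σ₀) E.logUdd =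
      E.logUdd * E.kumYdd (E.toKddHat D.qddUnit) * E.kumYdd (E.toKddHat u) := by
  obtain ⟨u, hu', h⟩ := hU₀
  refine ⟨u, hu', ?_⟩
  rw [T.conj_logUdd_of_smul_eq E hcc hu w hlogU hC σ₀ _ h, map_mul, map_mul, mul_assoc, mul_comm (E.kumYdd _)]

include hcc hlogU in
/-- **The binder `hLY`**: from `y • Ü = const(u_y)·Ü` on `Π^tp_Y`, `y·log(Ü) = log(Ü)·κ(u_y)`.
[cite: MochizukiEtTh2009, Prop 1.5 (iii) p.23] -/
theorem hLY_of_coordLaw (hC : D.Compat) (hUY : ∀ y ∈ D.GtpY, ∃ u ∈ D.unitsOKdd, y • udd = T.const u * udd) :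
    haveI := hC.GtpYddTheta_normal
    ∀ y ∈ D.GtpY, ∃ u ∈ D.unitsOKdd, ContH1.conj (MonoidHom.id D.GtpTheta) D.DeltaTheta (D.toTheta y) E.logUdd =
      E.logUdd * E.kumYdd (E.toKddHat u) := by
  intro y hy
  obtain ⟨u, hu', h⟩ := hUY y hy
  exact ⟨u, hu', T.conj_logUdd_of_smul_eq E hcc hu w hlogU hC y u h⟩

variable (x' : D.H1Theta (D.GtpYdd.map D.toTheta)) (hx' : D.inflTheta D.GtpYdd x' = T.kummerTheta)

include hcc hlogU hx' in
/-- **The binder `hx₀` — the printed display at the generator**: from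
`σ₀ • Θ̈ = const(u·q̈⁻¹)·Ü^{−2}·Θ̈` (Prop. 1.4 (ii), `a = 1`), the `Θ`-lift `x′` of `κ(Θ̈)` satisfies
`σ₀·x′ = x′·log(Ü)^{−2}·κ(q̈)^{−1}·κ(u)`. [cite: MochizukiEtTh2009, Prop 1.5 (iii) p.23] -/
theorem hx_of_thetaLaw (hC : D.Compat) {σ₀ : D.PiTemp}
    (hΘ₀ : ∃ u ∈ D.unitsOKdd, σ₀ • T.theta = T.const (u * D.qddUnit⁻¹) * udd ^ (-(2 : ℤ)) * T.theta) :
    haveI := hC.GtpYddTheta_normal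
    ∃ u ∈ D.unitsOKdd, ContH1.conj (MonoidHom.id D.GtpTheta) D.DeltaTheta (D.toTheta σ₀) x' =
      x' * E.logUdd ^ (-(2 : ℤ)) * E.kumYdd (E.toKddHat D.qddUnit) ^ (-(1 : ℤ)) * E.kumYdd (E.toKddHat u) := by
  haveI := hC.GtpYdd_normal
  haveI := hC.GtpYddTheta_normal
  obtain ⟨u, hu', h⟩ := hΘ₀
  refine ⟨u, hu', ?_⟩
  apply D.inflTheta_injective D.GtpYdd
  rw [D.inflTheta_conj_toTheta hC, hx', T.conj_kummerTheta_of_translate hu w σ₀ _ h, map_mul, map_mul, map_mul,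
    map_zpow, map_zpow, hx', hlogU, hcc, hcc, T.kummerConst_mul, T.kummerConst_inv, zpow_neg_one]
  simp only [mul_comm, mul_assoc]

include hcc hx' in
/-- **The binder `hxY`**: from `y • Θ̈ = const(u_y)·Θ̈` on `Π^tp_Y` ("`Θ̈(−Ü) = −Θ̈(Ü)`"), `y·x′ = x′·κ(u_y)`.
[cite: MochizukiEtTh2009, Prop 1.5 (iii) p.23] -/
theorem hxY_of_thetaUnitLaw (hC : D.Compat) (hΘY : ∀ y ∈ D.GtpY, ∃ u ∈ D.unitsOKdd, y • T.theta = T.const u * T.theta) :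
    haveI := hC.GtpYddTheta_normal
    ∀ y ∈ D.GtpY, ∃ u ∈ D.unitsOKdd, ContH1.conj (MonoidHom.id D.GtpTheta) D.DeltaTheta (D.toTheta y) x' =
      x' * E.kumYdd (E.toKddHat u) := by
  haveI := hC.GtpYdd_normal
  haveI := hC.GtpYddTheta_normal
  intro y hy
  obtain ⟨u, hu', h⟩ := hΘY y hy
  refine ⟨u, hu', ?_⟩
  apply D.inflTheta_injective D.GtpYdd
  rw [D.inflTheta_conj_toTheta hC, hx', map_mul, hx', hcc u, kummerTheta,
    T.conj_kummerContClass_of_smul_eq_const_mul T.theta_mem T.theta_mem T.thetaRoots T.thetaRoots y u h, mul_comm]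

end Displays

end ThetaKummerInput

/-! ### 3. Prop. 1.5 (iii) from the Kummer theory of functions -/

namespace EtaleThetaData

/-- `Prop15iii` only sees the Kummer datum and `η̈^Θ`: it transfers along `etaleThetaDataOfClass`.
[cite: MochizukiEtTh2009, Prop 1.5 (iii) p.23] -/
theorem prop15iii_iff_etaleThetaDataOfClass (E : D.EtaleThetaData) (hC : D.Compat) :
    Prop15iii E hC ↔ Prop15iii (E.toKummerData.etaleThetaDataOfClass E.etaDd) hC := Iff.rfl

/-- **Prop. 1.5 (iii) for ANY étale-theta datum whose class IS the Kummer class of `Θ̈`** (`E.etaDd = κ(Θ̈)`,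
the route of `ThetaKummerClass.lean`), from Props. 1.3; 1.4 (ii), (iii) as function-level inputs — binders:
the `Θ`-lift `x′` (Prop. 1.3), `ConstCompat` + `hlogU` (Prop. 1.4 (iii): the classes are Kummer classes of
functions), the four function identities (Prop. 1.4 (ii) at the deck generator and on `Π^tp_Y`), and the three
Kummer-side binders of the generator reductions (`hkres`, `hU`, `hQ` — theorems over a Kummer core, below); for
a bare Kummer datum `E₀` and a class use `E := E₀.etaleThetaDataOfClass κ(Θ̈)`, `hη := rfl`.
[cite: MochizukiEtTh2009, Prop 1.5 (iii) p.23] -/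
theorem prop15iii_of_thetaKummerInput (E : D.EtaleThetaData) (T : D.ThetaKummerInput) (hC : D.Compat)
    (hη : E.etaDd = T.kummerTheta) (hcc : T.ConstCompat E.toKummerData)
    {udd : T.Fn} (hu : udd ∈ MulAction.fixedPoints D.GtpYdd T.Fn) (w : RootSystem udd)
    (hlogU : D.inflTheta D.GtpYdd E.logUdd = T.coeff.kummerContClass D.GtpYdd w hu fun _ => T.isOpen_stabilizer _)
    (x' : D.H1Theta (D.GtpYdd.map D.toTheta)) (hx' : D.inflTheta D.GtpYdd x' = T.kummerTheta)
    (hres : ContH1.res (MonoidHom.id D.GtpTheta) D.DeltaTheta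
      (hC.deltaTheta_le_DtpYddTheta.trans (Subgroup.map_mono inf_le_left)) x' = D.logTheta)
    (hkres : ∀ u ∈ D.unitsOKdd, ContH1.res (MonoidHom.id D.GtpTheta) D.DeltaTheta
      (hC.deltaTheta_le_DtpYddTheta.trans (Subgroup.map_mono inf_le_left)) (E.kumYdd (E.toKddHat u)) = 1)
    (hU : haveI := hC.GtpYddTheta_normal
      ∀ σ : D.PiTemp, ∀ u ∈ D.unitsOKdd, ∃ u' ∈ D.unitsOKdd,
        ContH1.conj (MonoidHom.id D.GtpTheta) D.DeltaTheta (D.toTheta σ) (E.kumYdd (E.toKddHat u)) =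
          E.kumYdd (E.toKddHat u'))
    (hQ : haveI := hC.GtpYddTheta_normal
      ∀ σ : D.PiTemp, ∃ u ∈ D.unitsOKdd,
        ContH1.conj (MonoidHom.id D.GtpTheta) D.DeltaTheta (D.toTheta σ) (E.kumYdd (E.toKddHat D.qddUnit)) =
          E.kumYdd (E.toKddHat D.qddUnit) * E.kumYdd (E.toKddHat u))
    {σ₀ : D.PiTemp} (hσ₀ : D.toZ σ₀ = Multiplicative.ofAdd 1)
    (hU₀ : ∃ u ∈ D.unitsOKdd, σ₀ • udd = T.const (u * D.qddUnit) * udd)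
    (hUY : ∀ y ∈ D.GtpY, ∃ u ∈ D.unitsOKdd, y • udd = T.const u * udd)
    (hΘ₀ : ∃ u ∈ D.unitsOKdd, σ₀ • T.theta = T.const (u * D.qddUnit⁻¹) * udd ^ (-(2 : ℤ)) * T.theta)
    (hΘY : ∀ y ∈ D.GtpY, ∃ u ∈ D.unitsOKdd, y • T.theta = T.const u * T.theta) :
    Prop15iii E hC := by
  rw [prop15iii_iff_etaleThetaDataOfClass, hη]
  exact E.toKummerData.prop15iii_etaleThetaDataOfClass_of_generator hC T.kummerTheta x' hx' hres hkres hU hQ hσ₀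
    (T.hL_of_coordLaw _ hcc hu w hlogU hC hU₀) (T.hLY_of_coordLaw _ hcc hu w hlogU hC hUY)
    (T.hx_of_thetaLaw _ hcc hu w hlogU x' hx' hC hΘ₀) (T.hxY_of_thetaUnitLaw _ hcc x' hx' hC hΘY)

end EtaleThetaData

namespace KummerCore

variable (C : D.KummerCore) (T : D.ThetaKummerInput)

/-- **Prop. 1.5 (iii) over a KUMMER CORE from the Kummer theory of functions**: all Kummer-side inputs are
theorems (abc-iut-L2-t12 gen 5, `KummerDataOfCoreConj.lean`); binders = the `Θ`-lift of `κ(Θ̈)` (Prop. 1.3),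
`ConstCompat` + `hlogU` (Prop. 1.4 (iii)), and the function identities of Prop. 1.4 (ii).
[cite: MochizukiEtTh2009, Prop 1.5 (iii) p.23] -/
theorem prop15iii_etaleThetaDataOfClass_of_thetaKummerInput (hC : D.Compat) (hcc : T.ConstCompat C.toKummerData)
    {udd : T.Fn} (hu : udd ∈ MulAction.fixedPoints D.GtpYdd T.Fn) (w : RootSystem udd)
    (hlogU : D.inflTheta D.GtpYdd C.logUdd = T.coeff.kummerContClass D.GtpYdd w hu fun _ => T.isOpen_stabilizer _)
    (x' : D.H1Theta (D.GtpYdd.map D.toTheta)) (hx' : D.inflTheta D.GtpYdd x' = T.kummerTheta)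
    (hres : ContH1.res (MonoidHom.id D.GtpTheta) D.DeltaTheta
      (hC.deltaTheta_le_DtpYddTheta.trans (Subgroup.map_mono inf_le_left)) x' = D.logTheta)
    {σ₀ : D.PiTemp} (hσ₀ : D.toZ σ₀ = Multiplicative.ofAdd 1)
    (hU₀ : ∃ u ∈ D.unitsOKdd, σ₀ • udd = T.const (u * D.qddUnit) * udd)
    (hUY : ∀ y ∈ D.GtpY, ∃ u ∈ D.unitsOKdd, y • udd = T.const u * udd)
    (hΘ₀ : ∃ u ∈ D.unitsOKdd, σ₀ • T.theta = T.const (u * D.qddUnit⁻¹) * udd ^ (-(2 : ℤ)) * T.theta)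
    (hΘY : ∀ y ∈ D.GtpY, ∃ u ∈ D.unitsOKdd, y • T.theta = T.const u * T.theta) :
    Prop15iii (C.toKummerData.etaleThetaDataOfClass T.kummerTheta) hC :=
  C.prop15iii_etaleThetaDataOfClass_of_generator hC T.kummerTheta x' hx' hres hσ₀
    (T.hL_of_coordLaw C.toKummerData hcc hu w hlogU hC hU₀)
    (T.hLY_of_coordLaw C.toKummerData hcc hu w hlogU hC hUY)
    (T.hx_of_thetaLaw C.toKummerData hcc hu w hlogU x' hx' hC hΘ₀)
    (T.hxY_of_thetaUnitLaw C.toKummerData hcc x' hx' hC hΘY)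

section OfSection

variable (s : GQp p →* D.PiTemp) (hs : Continuous s) (hsec : ∀ σ : GQp p, D.aug (s σ) = σ)
  (hsY : D.GK.map s ≤ D.GtpY) (hsYdd : D.GKdd.map s ≤ D.GtpYdd)

include hsec in
/-- `ConstCompat` with the core's datum is `ConstCompat` with every section datum (their unit classes
coincide, abc-iut-L2-t6's `kumOfSection_toKddHatOfSection`). [cite: MochizukiEtTh2009, Prop 1.3 p.21] -/
theorem constCompat_toKummerDataOfSection (hcc : T.ConstCompat C.toKummerData) :
    T.ConstCompat (C.toKummerDataOfSection s hs hsec hsY hsYdd) := fun c => by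
  rw [← hcc c]
  exact congrArg (D.inflTheta D.GtpYdd) (C.kumOfSection_toKddHatOfSection s hs hsec hsYdd c)

/-- **Prop. 1.5 (iii) at the SECTION datum from the Kummer theory of functions** (the carrier
`KddHat = H¹(G_K̈, Δ_Θ)` on which points of `Ÿ` are evaluated). [cite: MochizukiEtTh2009, Prop 1.5 (iii) p.23] -/
theorem prop15iii_etaleThetaDataOfClass_ofSection_of_thetaKummerInput (hC : D.Compat)
    (hcc : T.ConstCompat C.toKummerData)
    {udd : T.Fn} (hu : udd ∈ MulAction.fixedPoints D.GtpYdd T.Fn) (w : RootSystem udd)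
    (hlogU : D.inflTheta D.GtpYdd C.logUdd = T.coeff.kummerContClass D.GtpYdd w hu fun _ => T.isOpen_stabilizer _)
    (x' : D.H1Theta (D.GtpYdd.map D.toTheta)) (hx' : D.inflTheta D.GtpYdd x' = T.kummerTheta)
    (hres : ContH1.res (MonoidHom.id D.GtpTheta) D.DeltaTheta
      (hC.deltaTheta_le_DtpYddTheta.trans (Subgroup.map_mono inf_le_left)) x' = D.logTheta)
    {σ₀ : D.PiTemp} (hσ₀ : D.toZ σ₀ = Multiplicative.ofAdd 1)
    (hU₀ : ∃ u ∈ D.unitsOKdd, σ₀ • udd = T.const (u * D.qddUnit) * udd)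
    (hUY : ∀ y ∈ D.GtpY, ∃ u ∈ D.unitsOKdd, y • udd = T.const u * udd)
    (hΘ₀ : ∃ u ∈ D.unitsOKdd, σ₀ • T.theta = T.const (u * D.qddUnit⁻¹) * udd ^ (-(2 : ℤ)) * T.theta)
    (hΘY : ∀ y ∈ D.GtpY, ∃ u ∈ D.unitsOKdd, y • T.theta = T.const u * T.theta) :
    Prop15iii ((C.toKummerDataOfSection s hs hsec hsY hsYdd).etaleThetaDataOfClass T.kummerTheta) hC :=
  C.prop15iii_etaleThetaDataOfClass_ofSection_of_generator s hs hsec hsY hsYdd hC T.kummerTheta x' hx' hres hσ₀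
    (T.hL_of_coordLaw _ (C.constCompat_toKummerDataOfSection T s hs hsec hsY hsYdd hcc) hu w hlogU hC hU₀)
    (T.hLY_of_coordLaw _ (C.constCompat_toKummerDataOfSection T s hs hsec hsY hsYdd hcc) hu w hlogU hC hUY)
    (T.hx_of_thetaLaw _ (C.constCompat_toKummerDataOfSection T s hs hsec hsY hsYdd hcc) hu w hlogU x' hx' hC hΘ₀)
    (T.hxY_of_thetaUnitLaw _ (C.constCompat_toKummerDataOfSection T s hs hsec hsY hsYdd hcc) x' hx' hC hΘY)

end OfSection

end KummerCore

end ThetaSetting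

end Literature.AnabelianGeometry.EtaleTheta

end
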